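import Summits.NavierStokesRegularity.FluidComputer.PalasekTowerFaceLacunarityLaws

/-!
# RE-TUNED RATES RECORDS for the crux `EpisodeBase` (stmt-NavierStokesRegularity-19179): three comparison records with certified
# register arithmetic (D-0014 ruling of the PTB tenure planner, ns-blowup STATUS 2026-08-27T08:39Z; holder ns-palasek-19179-p2 g5)

Cell `ns-blowup`. RECORD FILE (not a draft): the candidate re-tuned `TowerRates` of the holder's RE-TUNING BRIEF v1.2c (19179 evidence, brief of
record) as DEFINITIONS with dyadic closed forms and decimal brackets for the quantities the brief reads — level-`0` core Reynolds number
`Re₀ = N₀^{β−2}`, first lacunarity step `σ = N₀^{b−1}`, speed face `F = Y₁/Y₀ = σ^{β−1}` and whether the ORIGINAL pins (`θc₂ = (6/5)(5/3) = 2 ≤ F`)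
stay admissible, Burgers factor `B = N₀^{β/2−b} = √Re₀/σ` (ecbridge-8 p433323 / p513535), window `0` in level-`0` strain times `4b²β log N₀`, and
the core-survival number `κ = N₀^{β−2b}/(4b²β log N₀)` (p511376) — next to `TowerRates.wide` (the item of record: `Re₀ 5.28`, `σ 1.741`, `F 2.056`,
`B 1.32`, window `61.7`, `κ 0.0282`) and `TowerRates.tuned = (2^24, 33/32, 12/5, 49/20)` (p517439 `PalasekTowerRegisterGlobalAt.lean`; numbers in
p519619 `PalasekTowerFaceNumbersTuned.lean`: `Re₀ 776`, `σ 1.682`, `F 2.071` — ORIGINAL pins admissible —, `B 16.56`, window `169.8`, `κ 1.62`; the MODEL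
child core meets all four level-`1` clauses with margin `6/5` there, p518674):

| record | (N₀, b) | Re₀ | σ | F (pins) | B | window₀ [strain times] | κ |
|---|---|---|---|---|---|---|---|
| `stretch` | (2^19, 41/40) | 194 | 1.389 | 1.585 (soft) | 10.02 | 132.8 | 0.75 |
| `deepA` | (2^22, 41/40) | 445 | 1.464 | 1.705 (soft) | 14.42 | 153.8 | 1.35 |
| `deepA'` | (2^23, 41/40) | 588 | 1.489 | 1.747 (soft) | 16.27 | 160.7 | 1.64 |
| `tuned` (p517439) | (2^24, 33/32) | 776 | 1.682 | 2.071 (ORIGINAL) | 16.56 | 169.8 | 1.62 |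

WHY `tuned` CARRIES THE NAME (holder's note to the planner's 08:39Z (2), which suggested `Re₀ ≈ 194` for it): the planner's re-base test (b)
(«four faces at margin ≥ 1.2») needs floor AND ceiling margins ≥ 6/5 simultaneously, i.e. a ceiling band `[500π/79, 4√2π·c₂]` of width ≥ 1.44
in `C√λB` — the ORIGINAL `c₂ = 5/3` band (width 1.49) qualifies, every soft band `c₂ ≤ F/θ < 1.59` at `Re₀ ≈ 194`, `b = 41/40` does not (≤ 1.42);
and the ported G-layer keeps `S.Pins 8 (6/5) ∧ S.Rigid` VERBATIM, which needs `F ≥ 2` (`tuned_sep`). `stretch` is typed here as the comparison row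
the planner named; re-naming is a one-line change if the planner prefers it. WHAT REMAINS AN INPUT (DIRECTOR-NS g7 #43 (3)): the one unmeasured
number the brief's lines need — `‖∇u‖·a/u` of a head-on event at `Re_a ≈ 10³` for the collision proxy; the persistence of the level-`0` strain at
the seed for the stretching line — is NOT bought by kit under rule #39 (1) without a NEW pre-registered instrument and the director's token.

LABEL: E–C register arithmetic (KERNEL: definitions + certified numerics). WHAT THIS IS NOT: not Navier–Stokes evidence; NOT a route edit; NOT an item —
the registration of 19179 (`TowerRates.wide`, Λ = 8, θ = 6/5, c₂ = 5/3; line `slot` v5) is UNCHANGED (D-0014).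

References: S. Palasek, arXiv:2605.13827 §3 (3.2), Rem. 1.5 [cite: Palasek2026ElementaryModel, §3 (3.2)]; RE-TUNING BRIEF v1.2c; K128.
-/

noncomputable section

namespace Summit.NavierStokesRegularity.FluidComputer.PalasekTowerClayBridge

open Real

namespace TowerRates

/-! ### Record `deepA` = (2^22, 41/40, 12/5, 49/20) — collision-corner comparison row of the brief (§6–§8); soft pins -/

/-- Rates record `deepA`: `(N₀, b, β, α) = (2^22, 41/40, 12/5, 49/20)` (DC1 `2b < β`, DC4 `β < 1 + √2`, `2 < α ≤ 5/2`).
[cite: Palasek2026ElementaryModel, §3 (3.2) and Rem. 1.5] -/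
def deepA : TowerRates where
  N₀ := 2 ^ 22
  b := 41 / 40
  β := 12 / 5
  α := 49 / 20
  one_lt_N₀ := by norm_num
  one_lt_b := by norm_num
  two_b_lt_β := by norm_num
  β_lt_α := by norm_num
  two_lt_α := by norm_num
  α_le := by norm_num
  β_lt_one_add_sqrt_two := by
    have h : (7 : ℝ) / 5 < Real.sqrt 2 := by
      rw [Real.lt_sqrt (by norm_num)]; norm_num
    linarith

/-- `N₀ = 2^22` as a real power. [folklore] -/
theorem deepA_N₀_eq : deepA.N₀ = (2 : ℝ) ^ (22 : ℝ) := by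
  simp only [deepA]; norm_num

/-- `Re₀ = N₀^{β−2} = 2^{44/5} ∈ (445, 446)`. [folklore] -/
theorem deepA_Re₀_bounds : 445 < deepA.N₀ ^ (deepA.β - 2) ∧ deepA.N₀ ^ (deepA.β - 2) < 446 := by
  have h : deepA.N₀ ^ (deepA.β - 2) = (2 : ℝ) ^ ((44 : ℝ) / 5) := by
    rw [deepA_N₀_eq, ← Real.rpow_mul (by norm_num)]; simp only [deepA]; norm_num
  rw [h]
  exact ⟨lt_two_rpow_of_pow_lt (a := 44) (m := 1) (r := 5) (by norm_num) (by norm_num),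
    two_rpow_lt_of_pow_lt (by norm_num) (a := 44) (m := 1) (r := 5) (by norm_num) (by norm_num)⟩

/-- `σ = N₀^{b−1} = 2^{11/20} ∈ (1.464, 1.465)`. [folklore] -/
theorem deepA_sigma_bounds : 1.464 < deepA.N₀ ^ (deepA.b - 1) ∧ deepA.N₀ ^ (deepA.b - 1) < 1.465 := by
  have h : deepA.N₀ ^ (deepA.b - 1) = (2 : ℝ) ^ ((11 : ℝ) / 20) := by
    rw [deepA_N₀_eq, ← Real.rpow_mul (by norm_num)]; simp only [deepA]; norm_num
  rw [h]
  exact ⟨lt_two_rpow_of_pow_lt (a := 11) (m := 1) (r := 20) (by norm_num) (by norm_num),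
    two_rpow_lt_of_pow_lt (by norm_num) (a := 11) (m := 1) (r := 20) (by norm_num) (by norm_num)⟩

/-- Speed face `F = Y₁/Y₀ = σ^{β−1} = 2^{77/100} ∈ (1.705, 1.706)` — below `θc₂ = 2`: the ORIGINAL pins are NOT
admissible on `deepA` (soft pins needed, e.g. `θ = 9/8`, `c₂ = 7/5`: `63/40 = 1.575`). [folklore] -/
theorem deepA_speedFace_bounds : 1.705 < deepA.Y 1 / deepA.Y 0 ∧ deepA.Y 1 / deepA.Y 0 < 1.706 := by
  have h : deepA.Y 1 / deepA.Y 0 = (2 : ℝ) ^ ((77 : ℝ) / 100) := by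
    rw [deepA.Y_one_div_Y_zero_eq_sigma_rpow, deepA_N₀_eq, ← Real.rpow_mul (by norm_num), ← Real.rpow_mul (by norm_num)]
    simp only [deepA]; norm_num
  rw [h]
  exact ⟨lt_two_rpow_of_pow_lt (a := 77) (m := 1) (r := 100) (by norm_num) (by norm_num),
    two_rpow_lt_of_pow_lt (by norm_num) (a := 77) (m := 1) (r := 100) (by norm_num) (by norm_num)⟩

/-- Burgers factor `B = N₀^{β/2−b} = 2^{77/20} ∈ (14.42, 14.43)`. [folklore] -/
theorem deepA_burgersFactor_bounds :
    14.42 < deepA.N 0 ^ (deepA.β / 2 - deepA.b) ∧ deepA.N 0 ^ (deepA.β / 2 - deepA.b) < 14.43 := by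
  have h : deepA.N 0 ^ (deepA.β / 2 - deepA.b) = (2 : ℝ) ^ ((77 : ℝ) / 20) := by
    rw [deepA.N_zero_eq_N₀, deepA_N₀_eq, ← Real.rpow_mul (by norm_num)]; simp only [deepA]; norm_num
  rw [h]
  exact ⟨lt_two_rpow_of_pow_lt (a := 77) (m := 1) (r := 20) (by norm_num) (by norm_num),
    two_rpow_lt_of_pow_lt (by norm_num) (a := 77) (m := 1) (r := 20) (by norm_num) (by norm_num)⟩

/-- Window `0` in level-`0` strain times `A₀w₀ = 4b²β·log N₀ = (55473/250)·log 2 ∈ (153.8, 153.9)` (wide `61.7`). [folklore] -/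
theorem deepA_window_strain_bounds :
    153.8 < 4 * deepA.b ^ 2 * deepA.β * Real.log deepA.N₀ ∧ 4 * deepA.b ^ 2 * deepA.β * Real.log deepA.N₀ < 153.9 := by
  rw [deepA_N₀_eq, Real.log_rpow (by norm_num)]
  simp only [deepA]
  have hl2lo := Real.log_two_gt_d9
  have hl2hi := Real.log_two_lt_d9
  constructor <;> nlinarith

/-- Core-survival number `κ = N₀^{β−2b}/(4b²β log N₀) ∈ (1.35, 1.36)` (wide `0.0282`). [folklore] -/
theorem deepA_coreSurvival_bounds :
    1.35 < (deepA.Y 0 / deepA.N 1) ^ 2 / (deepA.window 0 * deepA.Y 0 ^ 2) ∧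
      (deepA.Y 0 / deepA.N 1) ^ 2 / (deepA.window 0 * deepA.Y 0 ^ 2) < 1.36 := by
  have h : (deepA.Y 0 / deepA.N 1) ^ 2 / (deepA.window 0 * deepA.Y 0 ^ 2) =
      (2 : ℝ) ^ ((77 : ℝ) / 10) / ((55473 : ℝ) / 250 * Real.log 2) := by
    rw [deepA.coreSurvival_eq, deepA_N₀_eq, ← Real.rpow_mul (by norm_num), Real.log_rpow (by norm_num)]
    simp only [deepA]; norm_num; ring
  rw [h]
  have hlo : (207.9 : ℝ) < (2 : ℝ) ^ ((77 : ℝ) / 10) :=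
    lt_two_rpow_of_pow_lt (a := 77) (m := 1) (r := 10) (by norm_num) (by norm_num)
  have hhi : (2 : ℝ) ^ ((77 : ℝ) / 10) < 208.0 :=
    two_rpow_lt_of_pow_lt (by norm_num) (a := 77) (m := 1) (r := 10) (by norm_num) (by norm_num)
  have hl2lo := Real.log_two_gt_d9
  have hl2hi := Real.log_two_lt_d9
  have hden : 0 < (55473 : ℝ) / 250 * Real.log 2 := by positivity
  constructor
  · rw [lt_div_iff₀ hden]; nlinarith
  · rw [div_lt_iff₀ hden]; nlinarith

/-! ### Record `deepA'` = (2^23, 41/40, 12/5, 49/20) — at-clock collision corner of the brief (§8); soft pins -/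

/-- Rates record `deepA'`: `(N₀, b, β, α) = (2^23, 41/40, 12/5, 49/20)` (DC1 `2b < β`, DC4 `β < 1 + √2`, `2 < α ≤ 5/2`).
[cite: Palasek2026ElementaryModel, §3 (3.2) and Rem. 1.5] -/
def deepA' : TowerRates where
  N₀ := 2 ^ 23
  b := 41 / 40
  β := 12 / 5
  α := 49 / 20
  one_lt_N₀ := by norm_num
  one_lt_b := by norm_num
  two_b_lt_β := by norm_num
  β_lt_α := by norm_num
  two_lt_α := by norm_num
  α_le := by norm_num
  β_lt_one_add_sqrt_two := by
    have h : (7 : ℝ) / 5 < Real.sqrt 2 := by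
      rw [Real.lt_sqrt (by norm_num)]; norm_num
    linarith

/-- `N₀ = 2^23` as a real power. [folklore] -/
theorem deepAp_N₀_eq : deepA'.N₀ = (2 : ℝ) ^ (23 : ℝ) := by
  simp only [deepA']; norm_num

/-- `Re₀ = N₀^{β−2} = 2^{46/5} ∈ (588, 589)`. [folklore] -/
theorem deepAp_Re₀_bounds : 588 < deepA'.N₀ ^ (deepA'.β - 2) ∧ deepA'.N₀ ^ (deepA'.β - 2) < 589 := by
  have h : deepA'.N₀ ^ (deepA'.β - 2) = (2 : ℝ) ^ ((46 : ℝ) / 5) := by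
    rw [deepAp_N₀_eq, ← Real.rpow_mul (by norm_num)]; simp only [deepA']; norm_num
  rw [h]
  exact ⟨lt_two_rpow_of_pow_lt (a := 46) (m := 1) (r := 5) (by norm_num) (by norm_num),
    two_rpow_lt_of_pow_lt (by norm_num) (a := 46) (m := 1) (r := 5) (by norm_num) (by norm_num)⟩

/-- `σ = N₀^{b−1} = 2^{23/40} ∈ (1.489, 1.490)`. [folklore] -/
theorem deepAp_sigma_bounds : 1.489 < deepA'.N₀ ^ (deepA'.b - 1) ∧ deepA'.N₀ ^ (deepA'.b - 1) < 1.490 := by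
  have h : deepA'.N₀ ^ (deepA'.b - 1) = (2 : ℝ) ^ ((23 : ℝ) / 40) := by
    rw [deepAp_N₀_eq, ← Real.rpow_mul (by norm_num)]; simp only [deepA']; norm_num
  rw [h]
  exact ⟨lt_two_rpow_of_pow_lt (a := 23) (m := 1) (r := 40) (by norm_num) (by norm_num),
    two_rpow_lt_of_pow_lt (by norm_num) (a := 23) (m := 1) (r := 40) (by norm_num) (by norm_num)⟩

/-- Speed face `F = Y₁/Y₀ = σ^{β−1} = 2^{161/200} ∈ (1.747, 1.748)` — below `θc₂ = 2`: the ORIGINAL pins are NOT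
admissible on `deepA'` (soft pins needed, e.g. `θ = 9/8`, `c₂ = 7/5`: `63/40 = 1.575`). [folklore] -/
theorem deepAp_speedFace_bounds : 1.747 < deepA'.Y 1 / deepA'.Y 0 ∧ deepA'.Y 1 / deepA'.Y 0 < 1.748 := by
  have h : deepA'.Y 1 / deepA'.Y 0 = (2 : ℝ) ^ ((161 : ℝ) / 200) := by
    rw [deepA'.Y_one_div_Y_zero_eq_sigma_rpow, deepAp_N₀_eq, ← Real.rpow_mul (by norm_num), ← Real.rpow_mul (by norm_num)]
    simp only [deepA']; norm_num
  rw [h]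
  exact ⟨lt_two_rpow_of_pow_lt (a := 161) (m := 1) (r := 200) (by norm_num) (by norm_num),
    two_rpow_lt_of_pow_lt (by norm_num) (a := 161) (m := 1) (r := 200) (by norm_num) (by norm_num)⟩

/-- Burgers factor `B = N₀^{β/2−b} = 2^{161/40} ∈ (16.27, 16.28)`. [folklore] -/
theorem deepAp_burgersFactor_bounds :
    16.27 < deepA'.N 0 ^ (deepA'.β / 2 - deepA'.b) ∧ deepA'.N 0 ^ (deepA'.β / 2 - deepA'.b) < 16.28 := by
  have h : deepA'.N 0 ^ (deepA'.β / 2 - deepA'.b) = (2 : ℝ) ^ ((161 : ℝ) / 40) := by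
    rw [deepA'.N_zero_eq_N₀, deepAp_N₀_eq, ← Real.rpow_mul (by norm_num)]; simp only [deepA']; norm_num
  rw [h]
  exact ⟨lt_two_rpow_of_pow_lt (a := 161) (m := 1) (r := 40) (by norm_num) (by norm_num),
    two_rpow_lt_of_pow_lt (by norm_num) (a := 161) (m := 1) (r := 40) (by norm_num) (by norm_num)⟩

/-- Window `0` in level-`0` strain times `A₀w₀ = 4b²β·log N₀ = (115989/500)·log 2 ∈ (160.7, 160.8)` (wide `61.7`). [folklore] -/
theorem deepAp_window_strain_bounds :
    160.7 < 4 * deepA'.b ^ 2 * deepA'.β * Real.log deepA'.N₀ ∧ 4 * deepA'.b ^ 2 * deepA'.β * Real.log deepA'.N₀ < 160.8 := by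
  rw [deepAp_N₀_eq, Real.log_rpow (by norm_num)]
  simp only [deepA']
  have hl2lo := Real.log_two_gt_d9
  have hl2hi := Real.log_two_lt_d9
  constructor <;> nlinarith

/-- Core-survival number `κ = N₀^{β−2b}/(4b²β log N₀) ∈ (1.64, 1.65)` (wide `0.0282`). [folklore] -/
theorem deepAp_coreSurvival_bounds :
    1.64 < (deepA'.Y 0 / deepA'.N 1) ^ 2 / (deepA'.window 0 * deepA'.Y 0 ^ 2) ∧
      (deepA'.Y 0 / deepA'.N 1) ^ 2 / (deepA'.window 0 * deepA'.Y 0 ^ 2) < 1.65 := by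
  have h : (deepA'.Y 0 / deepA'.N 1) ^ 2 / (deepA'.window 0 * deepA'.Y 0 ^ 2) =
      (2 : ℝ) ^ ((161 : ℝ) / 20) / ((115989 : ℝ) / 500 * Real.log 2) := by
    rw [deepA'.coreSurvival_eq, deepAp_N₀_eq, ← Real.rpow_mul (by norm_num), Real.log_rpow (by norm_num)]
    simp only [deepA']; norm_num; ring
  rw [h]
  have hlo : (265.0 : ℝ) < (2 : ℝ) ^ ((161 : ℝ) / 20) :=
    lt_two_rpow_of_pow_lt (a := 161) (m := 1) (r := 20) (by norm_num) (by norm_num)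
  have hhi : (2 : ℝ) ^ ((161 : ℝ) / 20) < 265.1 :=
    two_rpow_lt_of_pow_lt (by norm_num) (a := 161) (m := 1) (r := 20) (by norm_num) (by norm_num)
  have hl2lo := Real.log_two_gt_d9
  have hl2hi := Real.log_two_lt_d9
  have hden : 0 < (115989 : ℝ) / 500 * Real.log 2 := by positivity
  constructor
  · rw [lt_div_iff₀ hden]; nlinarith
  · rw [div_lt_iff₀ hden]; nlinarith

/-! ### Record `stretch` = (2^19, 41/40, 12/5, 49/20) — the brief's Re₀ ≈ 150–200 STRETCHING-LINE register named by the planner (STATUS 2026-08-27T08:39Z (2)): `Re₀ = 2^{38/5} ≈ 194`; soft pins (`F < 2`) -/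

/-- Rates record `stretch`: `(N₀, b, β, α) = (2^19, 41/40, 12/5, 49/20)` (DC1 `2b < β`, DC4 `β < 1 + √2`, `2 < α ≤ 5/2`).
[cite: Palasek2026ElementaryModel, §3 (3.2) and Rem. 1.5] -/
def stretch : TowerRates where
  N₀ := 2 ^ 19
  b := 41 / 40
  β := 12 / 5
  α := 49 / 20
  one_lt_N₀ := by norm_num
  one_lt_b := by norm_num
  two_b_lt_β := by norm_num
  β_lt_α := by norm_num
  two_lt_α := by norm_num
  α_le := by norm_num
  β_lt_one_add_sqrt_two := by
    have h : (7 : ℝ) / 5 < Real.sqrt 2 := by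
      rw [Real.lt_sqrt (by norm_num)]; norm_num
    linarith

/-- `N₀ = 2^19` as a real power. [folklore] -/
theorem stretch_N₀_eq : stretch.N₀ = (2 : ℝ) ^ (19 : ℝ) := by
  simp only [stretch]; norm_num

/-- `Re₀ = N₀^{β−2} = 2^{38/5} ∈ (194, 195)`. [folklore] -/
theorem stretch_Re₀_bounds : 194 < stretch.N₀ ^ (stretch.β - 2) ∧ stretch.N₀ ^ (stretch.β - 2) < 195 := by
  have h : stretch.N₀ ^ (stretch.β - 2) = (2 : ℝ) ^ ((38 : ℝ) / 5) := by
    rw [stretch_N₀_eq, ← Real.rpow_mul (by norm_num)]; simp only [stretch]; norm_num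
  rw [h]
  exact ⟨lt_two_rpow_of_pow_lt (a := 38) (m := 1) (r := 5) (by norm_num) (by norm_num),
    two_rpow_lt_of_pow_lt (by norm_num) (a := 38) (m := 1) (r := 5) (by norm_num) (by norm_num)⟩

/-- `σ = N₀^{b−1} = 2^{19/40} ∈ (1.389, 1.390)`. [folklore] -/
theorem stretch_sigma_bounds : 1.389 < stretch.N₀ ^ (stretch.b - 1) ∧ stretch.N₀ ^ (stretch.b - 1) < 1.390 := by
  have h : stretch.N₀ ^ (stretch.b - 1) = (2 : ℝ) ^ ((19 : ℝ) / 40) := by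
    rw [stretch_N₀_eq, ← Real.rpow_mul (by norm_num)]; simp only [stretch]; norm_num
  rw [h]
  exact ⟨lt_two_rpow_of_pow_lt (a := 19) (m := 1) (r := 40) (by norm_num) (by norm_num),
    two_rpow_lt_of_pow_lt (by norm_num) (a := 19) (m := 1) (r := 40) (by norm_num) (by norm_num)⟩

/-- Speed face `F = Y₁/Y₀ = σ^{β−1} = 2^{133/200} ∈ (1.585, 1.586)` — below `θc₂ = 2`: the ORIGINAL pins are NOT
admissible on `stretch` (soft pins needed, e.g. `θ = 9/8`, `c₂ = 7/5`: `63/40 = 1.575`). [folklore] -/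
theorem stretch_speedFace_bounds : 1.585 < stretch.Y 1 / stretch.Y 0 ∧ stretch.Y 1 / stretch.Y 0 < 1.586 := by
  have h : stretch.Y 1 / stretch.Y 0 = (2 : ℝ) ^ ((133 : ℝ) / 200) := by
    rw [stretch.Y_one_div_Y_zero_eq_sigma_rpow, stretch_N₀_eq, ← Real.rpow_mul (by norm_num), ← Real.rpow_mul (by norm_num)]
    simp only [stretch]; norm_num
  rw [h]
  exact ⟨lt_two_rpow_of_pow_lt (a := 133) (m := 1) (r := 200) (by norm_num) (by norm_num),
    two_rpow_lt_of_pow_lt (by norm_num) (a := 133) (m := 1) (r := 200) (by norm_num) (by norm_num)⟩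

/-- Burgers factor `B = N₀^{β/2−b} = 2^{133/40} ∈ (10.02, 10.03)`. [folklore] -/
theorem stretch_burgersFactor_bounds :
    10.02 < stretch.N 0 ^ (stretch.β / 2 - stretch.b) ∧ stretch.N 0 ^ (stretch.β / 2 - stretch.b) < 10.03 := by
  have h : stretch.N 0 ^ (stretch.β / 2 - stretch.b) = (2 : ℝ) ^ ((133 : ℝ) / 40) := by
    rw [stretch.N_zero_eq_N₀, stretch_N₀_eq, ← Real.rpow_mul (by norm_num)]; simp only [stretch]; norm_num
  rw [h]
  exact ⟨lt_two_rpow_of_pow_lt (a := 133) (m := 1) (r := 40) (by norm_num) (by norm_num),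
    two_rpow_lt_of_pow_lt (by norm_num) (a := 133) (m := 1) (r := 40) (by norm_num) (by norm_num)⟩

/-- Window `0` in level-`0` strain times `A₀w₀ = 4b²β·log N₀ = (95817/500)·log 2 ∈ (132.8, 132.9)` (wide `61.7`). [folklore] -/
theorem stretch_window_strain_bounds :
    132.8 < 4 * stretch.b ^ 2 * stretch.β * Real.log stretch.N₀ ∧ 4 * stretch.b ^ 2 * stretch.β * Real.log stretch.N₀ < 132.9 := by
  rw [stretch_N₀_eq, Real.log_rpow (by norm_num)]
  simp only [stretch]
  have hl2lo := Real.log_two_gt_d9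
  have hl2hi := Real.log_two_lt_d9
  constructor <;> nlinarith

/-- Core-survival number `κ = N₀^{β−2b}/(4b²β log N₀) ∈ (0.75, 0.76)` (wide `0.0282`). [folklore] -/
theorem stretch_coreSurvival_bounds :
    0.75 < (stretch.Y 0 / stretch.N 1) ^ 2 / (stretch.window 0 * stretch.Y 0 ^ 2) ∧
      (stretch.Y 0 / stretch.N 1) ^ 2 / (stretch.window 0 * stretch.Y 0 ^ 2) < 0.76 := by
  have h : (stretch.Y 0 / stretch.N 1) ^ 2 / (stretch.window 0 * stretch.Y 0 ^ 2) =
      (2 : ℝ) ^ ((133 : ℝ) / 20) / ((95817 : ℝ) / 500 * Real.log 2) := by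
    rw [stretch.coreSurvival_eq, stretch_N₀_eq, ← Real.rpow_mul (by norm_num), Real.log_rpow (by norm_num)]
    simp only [stretch]; norm_num; ring
  rw [h]
  have hlo : (100.4 : ℝ) < (2 : ℝ) ^ ((133 : ℝ) / 20) :=
    lt_two_rpow_of_pow_lt (a := 133) (m := 1) (r := 20) (by norm_num) (by norm_num)
  have hhi : (2 : ℝ) ^ ((133 : ℝ) / 20) < 100.5 :=
    two_rpow_lt_of_pow_lt (by norm_num) (a := 133) (m := 1) (r := 20) (by norm_num) (by norm_num)
  have hl2lo := Real.log_two_gt_d9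
  have hl2hi := Real.log_two_lt_d9
  have hden : 0 < (95817 : ℝ) / 500 * Real.log 2 := by positivity
  constructor
  · rw [lt_div_iff₀ hden]; nlinarith
  · rw [div_lt_iff₀ hden]; nlinarith

end TowerRates

end Summit.NavierStokesRegularity.FluidComputer.PalasekTowerClayBridge

end
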